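import Summits.QuantumAdvantage.QuantumAdvantage.Theses.CubicForrelation
import Summits.QuantumAdvantage.QuantumAdvantage.Theorems.CubicForrelationNearExactIsExactRankTwoPencilPlanes
import Literature.Computability.QuantumComplexity.IQPForrelation

/-!
# `NearExactIsExact` (stmt-QuantumAdvantage-14043), line `direct-sum-amplification` — rank-two pencils (RP)

Stub `stub_rankTwoPencil` of the line `direct-sum-amplification` for the crux
`Summit.QuantumAdvantage.QuantumAdvantage.Theses.CubicForrelation.NearExactIsExact`.

**What.** Let `x ↦ M x` (`x ∈ 𝔽₂^a`) be an AFFINE family (`M(x ⊕ x′) = M x ⊕ M x′ ⊕ M 0`) of symmetric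
zero-diagonal `k × k` matrices over `𝔽₂`, each satisfying the Plücker/Pfaffian identities
`M_{ij}M_{i′j′} ⊕ M_{ii′}M_{jj′} ⊕ M_{ij′}M_{ji′} = 0` (rank `≤ 2`), with `M z = 0` for some `z`.  Then EITHER one
non-zero vector `w` lies in the row space of every non-zero member (`w = Σ_i s_i · row_i(M x)` over `𝔽₂`), OR the
zero set `Z = {z : M z = 0}` satisfies `2^a ≤ 8 · |Z|`.

**Proof.**  Entries are read in `ZMod 2` (`F x i j = [M x i j]`); the image `A = {F x}` is closed under addition
(`F x + F x′ = F(x ⊕ x′ ⊕ z₀)`), and every fibre of `F` injects into `Z` (`x ↦ x ⊕ x₁ ⊕ z₀`), so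
`2^a ≤ |A| · |Z|`; it remains to prove the DICHOTOMY `rp_core` — common row-space vector, or `A` inside the span of
three matrices (`|A| ≤ 8`, `rp_card_le`) — for an additively closed set `A` of alternating rank-`≤ 2` matrices.  The
plane toolkit (normal form `B = row_p ∧ row_q`, plane `P(B) = ⟨row_p, row_q⟩`, and TWO PLANES MEET: `P(B) ∩ P(B′) ≠ 0`
for non-zero `B, B′ ∈ A`, `rp_planesMeet`) is in `…Theorems/CubicForrelationNearExactIsExactRankTwoPencilPlanes.lean`.
Dichotomy: pick non-zero `B₁` and — unless `u = row_p B₁` is already a common vector — a non-zero `B₂` with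
`u ∉ P(B₂)`; they share `w ≠ 0`, `P₁ = ⟨w, u₁⟩`, `P₂ = ⟨w, u₂⟩` with `u₂ ∉ P₁`; put `W = ⟨w, u₁, u₂⟩`.  A plane
`P(B)` not containing `w` meets `P₁, P₂` in two distinct vectors of `W`, hence `P(B) ⊆ W`.  If `w` is not common,
some `P(B₄) ⊆ W` misses `w`; if moreover some `P(B₃) ⊄ W` (so `w ∈ P(B₃) = ⟨w, y₃⟩`, `y₃ ∉ W`), the common vector
of `P(B₃), P(B₄)` would lie in `⟨w, y₃⟩ ∩ W ∖ {w} = {0}` — contradiction.  So all planes lie in `W`, every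
`B = row_p ∧ row_q` expands (bilinearity, characteristic two) in `w ∧ u₁, w ∧ u₂, u₁ ∧ u₂`, and `|A| ≤ 2³`.

References (orientation only; everything here is proved): the common-vector mechanism is the one used in Prop. 4.1
of arXiv:2508.14265; "pairwise intersecting lines of a projective space pass through a point or lie in a plane" is
folklore.
-/

set_option linter.dupNamespace false -- D-0017: single-problem summit

namespace Summit.QuantumAdvantage.QuantumAdvantage.Theorems.CubicForrelation.NearExactIsExact

open Finset
open Submodule (span)
open Literature.Computability.QuantumComplexity
open Literature.Computability.QuantumComplexity.BuzetChailloux (bxor zeroVec)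

/-! ### The dichotomy -/

/-- At most `8` matrices lie in the span of three. [folklore] -/
theorem rp_card_le {k : ℕ} {A : Finset (Fin k → Fin k → ZMod 2)} {W₁ W₂ W₃ : Fin k → Fin k → ZMod 2}
    (h : ∀ B ∈ A, B ∈ span (ZMod 2) ({W₁, W₂, W₃} : Set (Fin k → Fin k → ZMod 2))) : A.card ≤ 8 := by
  let f : ZMod 2 × ZMod 2 × ZMod 2 → (Fin k → Fin k → ZMod 2) := fun c => c.1 • W₁ + c.2.1 • W₂ + c.2.2 • W₃
  have hsub : A ⊆ Finset.univ.image f := by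
    intro B hB
    obtain ⟨a, b, c, habc⟩ := Submodule.mem_span_triple.1 (h B hB)
    exact Finset.mem_image.2 ⟨(a, b, c), Finset.mem_univ _, habc⟩
  calc A.card ≤ (Finset.univ.image f).card := Finset.card_le_card hsub
    _ ≤ (Finset.univ : Finset (ZMod 2 × ZMod 2 × ZMod 2)).card := Finset.card_image_le
    _ = 8 := by simp

/-- THE DICHOTOMY for an additively closed set `A` of symmetric zero-diagonal Plücker (`rank ≤ 2`) matrices over
`ZMod 2`: either one non-zero vector is a row combination of every non-zero member, or `A` lies in the span of three
matrices. [folklore; cf. arXiv:2508.14265, Prop. 4.1] -/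
theorem rp_core {k : ℕ} (A : Finset (Fin k → Fin k → ZMod 2))
    (hadd : ∀ B ∈ A, ∀ B' ∈ A, B + B' ∈ A)
    (hd : ∀ B ∈ A, ∀ i, B i i = 0) (hs : ∀ B ∈ A, ∀ i j, B i j = B j i)
    (hpl : ∀ B ∈ A, ∀ i j i' j', B i j * B i' j' + B i i' * B j j' + B i j' * B j i' = 0) :
    (∃ y : Fin k → ZMod 2, y ≠ 0 ∧ ∀ B ∈ A, B ≠ 0 → ∃ s : Fin k → ZMod 2, ∀ l, y l = ∑ i, s i * B i l) ∨
    ∃ W₁ W₂ W₃ : Fin k → Fin k → ZMod 2, ∀ B ∈ A,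
      B ∈ span (ZMod 2) ({W₁, W₂, W₃} : Set (Fin k → Fin k → ZMod 2)) := by
  -- two planes of members always meet
  have meet : ∀ B ∈ A, ∀ p q, B p q = 1 → ∀ B' ∈ A, ∀ p' q', B' p' q' = 1 →
      ∃ e : Fin k → ZMod 2, e ≠ 0 ∧ e ∈ span (ZMod 2) ({B p, B q} : Set (Fin k → ZMod 2)) ∧
        e ∈ span (ZMod 2) ({B' p', B' q'} : Set (Fin k → ZMod 2)) := by
    intro B hB p q hpq B' hB' p' q' hpq'
    obtain ⟨hBnf, hpp, hqp, hqq⟩ := rp_nf (hd B hB) (hs B hB) (hpl B hB) hpq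
    obtain ⟨hB'nf, -, -, -⟩ := rp_nf (hd B' hB') (hs B' hB') (hpl B' hB') hpq'
    have hCA := hadd B hB B' hB'
    obtain ⟨x, z, hC⟩ := rp_cols (hd _ hCA) (hs _ hCA) (hpl _ hCA)
    exact rp_planesMeet hBnf hpp hpq hqp hqq hB'nf hpq' hC
  by_cases hleft : ∃ y : Fin k → ZMod 2, y ≠ 0 ∧ ∀ B ∈ A, B ≠ 0 → ∃ s : Fin k → ZMod 2, ∀ l, y l = ∑ i, s i * B i l
  · exact Or.inl hleft
  right
  have hno : ∀ y : Fin k → ZMod 2, y ≠ 0 →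
      ∃ B ∈ A, B ≠ 0 ∧ ¬ ∃ s : Fin k → ZMod 2, ∀ l, y l = ∑ i, s i * B i l := by
    intro y hy
    by_contra h'
    refine hleft ⟨y, hy, fun B hB hB0 => ?_⟩
    by_contra h''
    exact h' ⟨B, hB, hB0, h''⟩
  by_cases hA : ∀ B ∈ A, B = 0
  · refine ⟨0, 0, 0, fun B hB => ?_⟩
    rw [hA B hB]; exact Submodule.zero_mem _
  push Not at hA
  obtain ⟨B₁, hB₁A, hB₁0⟩ := hA
  obtain ⟨p₁, q₁, hpq₁⟩ := rp_exists_one hB₁0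
  obtain ⟨-, h1pp, h1qp, -⟩ := rp_nf (hd B₁ hB₁A) (hs B₁ hB₁A) (hpl B₁ hB₁A) hpq₁
  have hu0 : B₁ p₁ ≠ 0 := fun h => by
    have := congrFun h q₁; rw [hpq₁] at this; exact one_ne_zero this
  obtain ⟨B₂, hB₂A, hB₂0, hB₂u⟩ := hno (B₁ p₁) hu0
  obtain ⟨p₂, q₂, hpq₂⟩ := rp_exists_one hB₂0
  obtain ⟨-, h2pp, h2qp, -⟩ := rp_nf (hd B₂ hB₂A) (hs B₂ hB₂A) (hpl B₂ hB₂A) hpq₂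
  obtain ⟨w, hw0, hw1, hw2⟩ := meet B₁ hB₁A p₁ q₁ hpq₁ B₂ hB₂A p₂ q₂ hpq₂
  obtain ⟨u₁, hu₁0, hu₁w, hK₁⟩ := rp_rebase h1pp hpq₁ h1qp hw1 hw0
  obtain ⟨u₂, hu₂0, hu₂w, hK₂⟩ := rp_rebase h2pp hpq₂ h2qp hw2 hw0
  set W := span (ZMod 2) ({w, u₁, u₂} : Set (Fin k → ZMod 2)) with hWdef
  obtain ⟨hK₁W, hK₂W⟩ := rp_pair_le_triple w u₁ u₂
  have hwW : w ∈ W := Submodule.subset_span (Set.mem_insert _ _)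
  -- `u₂ ∉ P₁`
  have hu₂ : u₂ ∉ span (ZMod 2) ({w, u₁} : Set (Fin k → ZMod 2)) := by
    intro h
    apply hB₂u
    apply rp_inIm B₂ p₂ q₂
    rw [hK₂]
    obtain ⟨hh1, hh2⟩ := rp_K_gen (rp_inl w u₁) h hw0 hu₂0 hu₂w.symm
    have h3 : B₁ p₁ ∈ span (ZMod 2) ({w, u₁} : Set (Fin k → ZMod 2)) := by rw [← hK₁]; exact rp_inl _ _
    exact rp_span_pair_le hh1 hh2 h3
  -- every plane contains `w` or lies in `W`
  have step3 : ∀ B ∈ A, ∀ p q, B p q = 1 →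
      w ∈ span (ZMod 2) ({B p, B q} : Set (Fin k → ZMod 2)) ∨
        span (ZMod 2) ({B p, B q} : Set (Fin k → ZMod 2)) ≤ W := by
    intro B hB p q hpq
    by_cases hw : w ∈ span (ZMod 2) ({B p, B q} : Set (Fin k → ZMod 2))
    · exact Or.inl hw
    right
    obtain ⟨e₁, he₁0, he₁B, he₁1⟩ := meet B hB p q hpq B₁ hB₁A p₁ q₁ hpq₁
    obtain ⟨e₂, he₂0, he₂B, he₂2⟩ := meet B hB p q hpq B₂ hB₂A p₂ q₂ hpq₂
    rw [hK₁] at he₁1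
    rw [hK₂] at he₂2
    have hne : e₁ ≠ e₂ := by
      intro he
      rw [← he] at he₂2
      rcases rp_K_cases he₁1 with h | h | h | h
      · exact he₁0 h
      · exact hw (by rw [← h]; exact he₁B)
      · rw [h] at he₂2
        exact hu₂ (rp_K_gen (rp_inl w u₂) he₂2 hw0 hu₁0 hu₁w.symm).2
      · rw [h] at he₂2
        have hu₁' : u₁ ∈ span (ZMod 2) ({w, u₂} : Set (Fin k → ZMod 2)) := by
          have := Submodule.add_mem _ (rp_inl w u₂) he₂2
          rwa [rp_add_cancel_left] at this
        exact hu₂ (rp_K_gen (rp_inl w u₂) hu₁' hw0 hu₁0 hu₁w.symm).2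
    obtain ⟨hg1, hg2⟩ := rp_K_gen he₁B he₂B he₁0 he₂0 hne
    exact (rp_span_pair_le hg1 hg2).trans (rp_span_pair_le (hK₁W he₁1) (hK₂W he₂2))
  -- a plane inside `W` missing `w`
  obtain ⟨B₄, hB₄A, hB₄0, hB₄w⟩ := hno w hw0
  obtain ⟨p₄, q₄, hpq₄⟩ := rp_exists_one hB₄0
  have hK₄w : w ∉ span (ZMod 2) ({B₄ p₄, B₄ q₄} : Set (Fin k → ZMod 2)) :=
    fun h => hB₄w (rp_inIm B₄ p₄ q₄ h)
  have hK₄W : span (ZMod 2) ({B₄ p₄, B₄ q₄} : Set (Fin k → ZMod 2)) ≤ W :=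
    (step3 B₄ hB₄A p₄ q₄ hpq₄).resolve_left hK₄w
  by_cases hall : ∀ B ∈ A, ∀ p q, B p q = 1 → span (ZMod 2) ({B p, B q} : Set (Fin k → ZMod 2)) ≤ W
  · -- all planes inside `W`: expand `row_p ∧ row_q` in `w ∧ u₁, w ∧ u₂, u₁ ∧ u₂`
    refine ⟨fun l t => w l * u₁ t + u₁ l * w t, fun l t => w l * u₂ t + u₂ l * w t,
      fun l t => u₁ l * u₂ t + u₂ l * u₁ t, fun B hB => ?_⟩
    by_cases hB0 : B = 0
    · rw [hB0]; exact Submodule.zero_mem _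
    obtain ⟨p, q, hpq⟩ := rp_exists_one hB0
    obtain ⟨hBnf, -, -, -⟩ := rp_nf (hd B hB) (hs B hB) (hpl B hB) hpq
    have hBW := hall B hB p q hpq
    obtain ⟨α, β, γ, hBp⟩ := Submodule.mem_span_triple.1 (hBW (rp_inl (B p) (B q)))
    obtain ⟨α', β', γ', hBq⟩ := Submodule.mem_span_triple.1 (hBW (rp_inr (B p) (B q)))
    refine Submodule.mem_span_triple.2 ⟨α * β' + α' * β, α * γ' + α' * γ, β * γ' + β' * γ, ?_⟩
    funext l t
    have e1 := congrFun hBp l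
    have e2 := congrFun hBq t
    have e3 := congrFun hBq l
    have e4 := congrFun hBp t
    simp only [Pi.add_apply, Pi.smul_apply, smul_eq_mul] at e1 e2 e3 e4 ⊢
    rw [hBnf l t, ← e1, ← e2, ← e3, ← e4]
    have h2 : (2 : ZMod 2) = 0 := by decide
    linear_combination (-(α * α' * (w l * w t) + β * β' * (u₁ l * u₁ t) + γ * γ' * (u₂ l * u₂ t))) * h2
  · -- some plane sticks out of `W`: contradiction
    exfalso
    push Not at hall
    obtain ⟨B₃, hB₃A, p₃, q₃, hpq₃, hK₃W⟩ := hall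
    have hK₃w : w ∈ span (ZMod 2) ({B₃ p₃, B₃ q₃} : Set (Fin k → ZMod 2)) :=
      (step3 B₃ hB₃A p₃ q₃ hpq₃).resolve_right hK₃W
    obtain ⟨y₃, hy₃K, hy₃W⟩ : ∃ y₃, y₃ ∈ span (ZMod 2) ({B₃ p₃, B₃ q₃} : Set (Fin k → ZMod 2)) ∧ y₃ ∉ W := by
      by_contra h
      push Not at h
      exact hK₃W fun y hy => h y hy
    obtain ⟨e, he0, he3, he4⟩ := meet B₃ hB₃A p₃ q₃ hpq₃ B₄ hB₄A p₄ q₄ hpq₄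
    have heW : e ∈ W := hK₄W he4
    have hy₃0 : y₃ ≠ 0 := fun h => hy₃W (by rw [h]; exact Submodule.zero_mem _)
    have hwy₃ : w ≠ y₃ := fun h => hy₃W (by rw [← h]; exact hwW)
    obtain ⟨hg1, hg2⟩ := rp_K_gen hK₃w hy₃K hw0 hy₃0 hwy₃
    have he' : e ∈ span (ZMod 2) ({w, y₃} : Set (Fin k → ZMod 2)) := rp_span_pair_le hg1 hg2 he3
    rcases rp_K_cases he' with h | h | h | h
    · exact he0 h
    · exact hK₄w (by rw [← h]; exact he4)
    · exact hy₃W (by rw [← h]; exact heW)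
    · apply hy₃W
      have := Submodule.add_mem _ hwW heW
      rwa [h, rp_add_cancel_left] at this

/-! ### The registered statement -/

/-- **Rank-two pencils** (stub RP of the line `direct-sum-amplification`).  Let `x ↦ M x` (`x ∈ 𝔽₂^a`) be an affine
family (`M(x ⊕ x′) = M x ⊕ M x′ ⊕ M 0`) of symmetric zero-diagonal `k × k` Boolean matrices, each satisfying the
Plücker/Pfaffian identities `M_{ij}M_{i′j′} ⊕ M_{ii′}M_{jj′} ⊕ M_{ij′}M_{ji′} = 0` (rank `≤ 2`), and suppose `M z = 0`
for some `z`.  Then either one non-zero `w` lies in the row space of every non-zero member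
(`w = Σ_i s_i · row_i(M x)` over `𝔽₂`), or the zero set `Z = {z : M z = 0}` has `2^a ≤ 8 · |Z|`.
Proof: `rp_core` (dichotomy for the additively closed image, read in `ZMod 2`) and a fibre count
(every fibre of `x ↦ M x` injects into `Z`). [folklore linear algebra; cf. arXiv:2508.14265, Prop. 4.1] -/
theorem stub_rankTwoPencil :
    ∀ (a k : ℕ) (M : (Fin a → Bool) → Fin k → Fin k → Bool),
      (∀ x i, M x i i = false) → (∀ x i j, M x i j = M x j i) →
      (∀ x x' i j, M (bxor x x') i j = (M x i j ^^ M x' i j ^^ M zeroVec i j)) →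
      (∀ x i j i' j', ((M x i j && M x i' j') ^^ (M x i i' && M x j j') ^^ (M x i j' && M x j i')) = false) →
      (∃ z, ∀ i j, M z i j = false) →
      (∃ w : Fin k → Bool, w ≠ zeroVec ∧ ∀ x, (∃ i j, M x i j = true) →
          ∃ s : Fin k → Bool, ∀ l, (if w l then (1 : ZMod 2) else 0) =
            ∑ i, (if s i then (1 : ZMod 2) else 0) * (if M x i l then (1 : ZMod 2) else 0)) ∨
      2 ^ a ≤ 8 * (univ.filter fun z : Fin a → Bool => ∀ i j, M z i j = false).card := by
  intro a k M h1 h2 h3 h4 h5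
  obtain ⟨z₀, hz₀⟩ := h5
  obtain ⟨F, hF⟩ : ∃ F : (Fin a → Bool) → Fin k → Fin k → ZMod 2,
      ∀ x i j, F x i j = if M x i j then 1 else 0 := ⟨fun x i j => if M x i j then 1 else 0, fun _ _ _ => rfl⟩
  -- the family read in `ZMod 2` is affine with a zero, hence its image is additively closed
  have hFadd : ∀ x x', F x + F x' = F (bxor (bxor x x') z₀) := by
    intro x x'
    funext i j
    rw [Pi.add_apply, Pi.add_apply, hF, hF, hF, h3, h3, hz₀]
    generalize M x i j = b₁
    generalize M x' i j = b₂
    generalize M zeroVec i j = b₃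
    revert b₁ b₂ b₃
    decide
  set A : Finset (Fin k → Fin k → ZMod 2) := univ.image F with hAdef
  have hmemA : ∀ x, F x ∈ A := fun x => mem_image_of_mem F (mem_univ x)
  have hA_add : ∀ B ∈ A, ∀ B' ∈ A, B + B' ∈ A := by
    intro B hB B' hB'
    obtain ⟨x, -, rfl⟩ := mem_image.1 hB
    obtain ⟨x', -, rfl⟩ := mem_image.1 hB'
    rw [hFadd]; exact hmemA _
  have hA_d : ∀ B ∈ A, ∀ i, B i i = 0 := by
    intro B hB i
    obtain ⟨x, -, rfl⟩ := mem_image.1 hB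
    rw [hF, h1]; rfl
  have hA_s : ∀ B ∈ A, ∀ i j, B i j = B j i := by
    intro B hB i j
    obtain ⟨x, -, rfl⟩ := mem_image.1 hB
    rw [hF, hF, h2]
  have hA_pl : ∀ B ∈ A, ∀ i j i' j', B i j * B i' j' + B i i' * B j j' + B i j' * B j i' = 0 := by
    intro B hB i j i' j'
    obtain ⟨x, -, rfl⟩ := mem_image.1 hB
    simp only [hF]
    exact rp_b_pl _ _ _ _ _ _ (h4 x i j i' j')
  rcases rp_core A hA_add hA_d hA_s hA_pl with ⟨y, hy0, hy⟩ | ⟨W₁, W₂, W₃, hW⟩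
  · -- a common vector, read back in `Bool`
    left
    refine ⟨fun l => decide (y l = 1), ?_, ?_⟩
    · intro hw
      apply hy0
      funext l
      have h := congrFun hw l
      simp only [zeroVec, decide_eq_false_iff_not] at h
      rcases (by decide : ∀ a : ZMod 2, a = 0 ∨ a = 1) (y l) with e | e
      · exact e
      · exact absurd e h
    · rintro x ⟨i, j, hij⟩
      have hB0 : F x ≠ 0 := by
        intro h0
        have := congrFun (congrFun h0 i) j
        rw [hF, hij, Pi.zero_apply, Pi.zero_apply] at this
        exact one_ne_zero this
      obtain ⟨s, hs⟩ := hy (F x) (hmemA x) hB0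
      refine ⟨fun i => decide (s i = 1), fun l => ?_⟩
      dsimp only
      rw [rp_b_dec (y l), hs l]
      refine Finset.sum_congr rfl fun i _ => ?_
      rw [rp_b_dec (s i), hF]
  · -- at most `8` matrices: count the fibres
    right
    have hcard : A.card ≤ 8 := rp_card_le hW
    have hfib : ∀ B ∈ A, (univ.filter fun x : Fin a → Bool => F x = B).card ≤
        (univ.filter fun z : Fin a → Bool => ∀ i j, M z i j = false).card := by
      intro B hB
      obtain ⟨x₁, -, rfl⟩ := mem_image.1 hB
      refine card_le_card_of_injOn (fun x => bxor (bxor x x₁) z₀) ?_ ?_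
      · intro x hx
        have hx' : F x = F x₁ := (mem_filter.1 (mem_coe.1 hx)).2
        refine mem_coe.2 (mem_filter.2 ⟨mem_univ _, fun i j => ?_⟩)
        have h0 : F (bxor (bxor x x₁) z₀) = 0 := by
          rw [← hFadd, hx']
          funext i' j'
          exact CharTwo.add_self_eq_zero _
        have := congrFun (congrFun h0 i) j
        rw [hF, Pi.zero_apply, Pi.zero_apply] at this
        exact (rp_b_zero_iff _).1 this
      · intro x _ x' _ h
        funext i
        have hi : ((x i ^^ x₁ i) ^^ z₀ i) = ((x' i ^^ x₁ i) ^^ z₀ i) := congrFun h i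
        revert hi
        generalize x i = b₁
        generalize x' i = b₂
        generalize x₁ i = b₃
        generalize z₀ i = b₄
        revert b₁ b₂ b₃ b₄
        decide
    calc 2 ^ a = (univ : Finset (Fin a → Bool)).card := by
          rw [card_univ, Fintype.card_fun, Fintype.card_bool, Fintype.card_fin]
      _ = ∑ B ∈ A, (univ.filter fun x : Fin a → Bool => F x = B).card :=
          card_eq_sum_card_fiberwise fun x _ => mem_coe.2 (hmemA x)
      _ ≤ ∑ B ∈ A, (univ.filter fun z : Fin a → Bool => ∀ i j, M z i j = false).card := sum_le_sum hfib
      _ = A.card * (univ.filter fun z : Fin a → Bool => ∀ i j, M z i j = false).card := by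
          rw [sum_const, smul_eq_mul]
      _ ≤ 8 * (univ.filter fun z : Fin a → Bool => ∀ i j, M z i j = false).card :=
          Nat.mul_le_mul_right _ hcard

end Summit.QuantumAdvantage.QuantumAdvantage.Theorems.CubicForrelation.NearExactIsExact
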